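import Mathlib.LinearAlgebra.Matrix.ToLin
import Literature.Topology.FourManifolds.KhComplex
import Literature.Topology.FourManifolds.KhFlipReach
import Literature.Topology.FourManifolds.KhComplexQDegreeProofs
import Literature.Topology.FourManifolds.KhFaces
import HarnessLib

/-!
# `d² = 0` for the Khovanov complex of a Gauss diagram, from merge-or-split

This file proves the planarity-free part of the named fact
`GaussDiagram.khovanovD_comp_khovanovD` of `Literature.Topology.FourManifolds.KhComplex`
(Khovanov (2000), Prop. 8: the cube of resolutions is commutative, hence — with the Koszul
signs — the differential of the Khovanov complex squares to zero):

* `khovanovD_comp_khovanovD_of_isMergeAt_or_isSplitAt`: if at every `0`-smoothed chord of every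
  state of the Gauss diagram `G` the flip `0 → 1` is a merge or a split (no one-to-one
  bifurcation), then `khovanovD R h t (i + 1) (i + 2) ∘ khovanovD R h t i (i + 1) = 0` for every
  commutative ring `R`, every Frobenius system `(h, t)` and every `i`;
* hence `khovanovD_comp_khovanovD_of_dichotomy`: the named fact `khovanovD_comp_khovanovD` follows
  from the named fact `isMergeAt_or_isSplitAt_of_hasGaussDiagram` (merge-or-split for diagrams
  of knots — the only place where planarity, i.e. the realisability hypothesis `hG`, enters).

The proof: an entry of `d²` is `∑ₓ ⟨d s, x⟩ ⟨d x, s'⟩` over enhanced states `x`; it vanishes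
termwise unless `s'.state` is `s.state` with two `0`-smoothings `i ≠ j` flipped, and then it is
the sum of the contributions of the two paths `s.state → σᵢ → s'.state` and
`s.state → σⱼ → s'.state` of a two-dimensional face of the cube. Each incidence number is a
Koszul sign times an abstract edge value (`incidence_eq_edgeVal`, using the surgery description
of the circles along an edge, `IsMergeAt.surg` / `IsSplitAt.surg` from `KhFlipReach`); summing
over the enhanced states with a fixed state is summing over labellings of its circles
(`sum_ite_state_eq`); the unsigned face sums agree by the abstract face theorem
`KhFace.face_comm` (`KhFaces`), and the Koszul signs of the two paths are opposite
(`edgeSign_mul_edgeSign_update`).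

## Sources

* M. Khovanov, *A categorification of the Jones polynomial*, Duke Math. J. 101 (2000) 359–426,
  §3.3 (skew-commutative cubes, the sign cube `E_I`), §4.2, Prop. 8.
* D. Bar-Natan, *On Khovanov's categorification of the Jones polynomial*, Algebr. Geom. Topol. 2
  (2002) 337–370, §3.2 (faces commute; signs `(-1)^{#{j<i : ξ_j = 1}}` make them anticommute).
* O. Viro, *Khovanov homology, its definitions and ramifications*, Fund. Math. 184 (2004)
  317–342, §5.2.
* V. O. Manturov, *Khovanov homology for virtual knots with arbitrary coefficients*, Izv. Math.
  71 (2007) 967–999 (why merge-or-split is needed: with one-to-one bifurcations `d² ≠ 0`).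
* Mathlib: `Matrix.toLin'_mul`, `Matrix.mul_apply`, `Finset.sum_subtype`, `Fintype.sum_equiv`,
  `Function.update_comm`.
-/

open Function Finset

noncomputable section

namespace Literature.Topology.FourManifolds

namespace KhFace

/-- The edge value of a merge is the merge incidence number. [folklore] -/
theorem edgeVal_merge {X : Type*} [Fintype X] (R : Type) [CommRing R] (h t : R) {Y Y' : Type*}
    [DecidableEq Y] [DecidableEq Y'] (c : X → Y) (c' : X → Y') (la mu : X → Bool) (α β : X) :
    edgeVal R h t Kind.merge c c' la mu α β = mergeInc R h t c' la mu α β := rfl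

/-- The edge value of a split is the split incidence number. [folklore] -/
theorem edgeVal_split {X : Type*} [Fintype X] (R : Type) [CommRing R] (h t : R) {Y Y' : Type*}
    [DecidableEq Y] [DecidableEq Y'] (c : X → Y) (c' : X → Y') (la mu : X → Bool) (α β : X) :
    edgeVal R h t Kind.split c c' la mu α β = splitInc R h t c la mu α β := rfl

end KhFace

namespace GaussDiagram

variable {G : GaussDiagram}

/-! ## The surgery relation along an edge of the cube -/

/-- Along a merge edge the circles of `σ[i ↦ 1]` are obtained from those of `σ` by uniting the
two circles through the local strands (`KhFlipReach`), in the form of the abstract surgery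
relation of `KhFaces`. Viro (2004), §5.2; Bar-Natan (2002), §3.1. [cite: Viro2004, §5.2] -/
theorem IsMergeAt.surg {σ : G.State} {i : Fin G.n} (h : G.IsMergeAt σ i) :
    KhFace.Surg (G.circleOf σ) (G.circleOf (Function.update σ i true)) (G.arcIn (G.overPos i))
      (G.arcOut (G.overPos i)) where
  ne := h.2
  rel x y := by
    simp only [circleOf_eq_iff]
    rw [h.reachable_update_iff x y, MergedReach]
    constructor
    · rintro (hxy | ⟨hxa, hby⟩ | ⟨hxb, hay⟩)
      · exact Or.inl hxy
      · exact Or.inr ⟨Or.inl hxa, Or.inr hby.symm⟩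
      · exact Or.inr ⟨Or.inr hxb, Or.inl hay.symm⟩
    · rintro (hxy | ⟨hxa | hxb, hya | hyb⟩)
      · exact Or.inl hxy
      · exact Or.inl (hxa.trans hya.symm)
      · exact Or.inr (Or.inl ⟨hxa, hyb.symm⟩)
      · exact Or.inr (Or.inr ⟨hxb, hya.symm⟩)
      · exact Or.inl (hxb.trans hyb.symm)

/-- Along a split edge the circles of `σ` are obtained from those of `σ[i ↦ 1]` by uniting the
two new circles through the local strands (`KhFlipReach`), in the form of the abstract surgery
relation of `KhFaces`. Viro (2004), §5.2; Bar-Natan (2002), §3.1. [cite: Viro2004, §5.2] -/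
theorem IsSplitAt.surg {σ : G.State} {i : Fin G.n} (h : G.IsSplitAt σ i) :
    KhFace.Surg (G.circleOf (Function.update σ i true)) (G.circleOf σ) (G.arcIn (G.overPos i))
      (G.arcOut (G.overPos i)) where
  ne := h.2
  rel x y := by
    simp only [circleOf_eq_iff]
    rw [h.reachable_iff x y, MergedReach]
    constructor
    · rintro (hxy | ⟨hxa, hby⟩ | ⟨hxb, hay⟩)
      · exact Or.inl hxy
      · exact Or.inr ⟨Or.inl hxa, Or.inr hby.symm⟩
      · exact Or.inr ⟨Or.inr hxb, Or.inl hay.symm⟩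
    · rintro (hxy | ⟨hxa | hxb, hya | hyb⟩)
      · exact Or.inl hxy
      · exact Or.inl (hxa.trans hya.symm)
      · exact Or.inr (Or.inl ⟨hxa, hyb.symm⟩)
      · exact Or.inr (Or.inr ⟨hxb, hya.symm⟩)
      · exact Or.inl (hxb.trans hyb.symm)

/-- The **kind** of the edge `σ → σ[i ↦ 1]`: a merge if `IsMergeAt σ i`, a split otherwise
(meaningful when the edge is a merge or a split). Bar-Natan (2002), §3.1. [cite: BarNatan2002] -/
def kindAt (σ : G.State) (i : Fin G.n) : KhFace.Kind :=
  if G.IsMergeAt σ i then KhFace.Kind.merge else KhFace.Kind.split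

/-- A merge-or-split edge satisfies the surgery relation of its kind (stated for any state `τ'`
equal to `σ[i ↦ 1]`, to absorb the order of two commuting updates). [folklore] -/
theorem edgeOK_kindAt {σ τ' : G.State} {i : Fin G.n} (hms : G.IsMergeAt σ i ∨ G.IsSplitAt σ i)
    (hτ' : τ' = Function.update σ i true) :
    KhFace.EdgeOK (G.kindAt σ i) (G.circleOf σ) (G.circleOf τ') (G.arcIn (G.overPos i))
      (G.arcOut (G.overPos i)) := by
  subst hτ'
  unfold kindAt
  by_cases hm : G.IsMergeAt σ i
  · rw [if_pos hm]
    exact hm.surg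
  · rw [if_neg hm]
    exact (hms.resolve_left hm).surg

/-! ## Incidence numbers as signed edge values -/

section Ring

variable {R : Type} [CommRing R]

/-- A nonzero incidence number `⟨d s, x⟩` comes from the flip of a single `0`-smoothing. [folklore] -/
theorem exists_of_incidence_ne_zero {h t : R} {s x : G.EnhancedState}
    (h0 : G.incidence R h t s x ≠ 0) :
    ∃ i, s.state i = false ∧ x.state = Function.update s.state i true := by
  by_contra hne
  unfold incidence at h0
  exact h0 (by rw [dif_neg hne])

/-- **Incidence number = Koszul sign × edge value.** Along a merge-or-split edge
`s.state → x.state = s.state[i ↦ 1]`, the incidence number of `KhComplex` is the sign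
`edgeSign s.state i` times the abstract edge value of `KhFaces` for the circle maps of the two
states, the labels, and the local strands at chord `i`. Viro (2004), §5.2. [cite: Viro2004, §5.2] -/
theorem incidence_eq_edgeVal (h t : R) {s x : G.EnhancedState} {i : Fin G.n}
    (hms : G.IsMergeAt s.state i ∨ G.IsSplitAt s.state i) (hσ : s.state i = false)
    (hx : x.state = Function.update s.state i true) :
    G.incidence R h t s x = (edgeSign s.state i : R) *
      KhFace.edgeVal R h t (G.kindAt s.state i) (G.circleOf s.state) (G.circleOf x.state)
        s.label x.label (G.arcIn (G.overPos i)) (G.arcOut (G.overPos i)) := by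
  have hi : ∃ j, s.state j = false ∧ x.state = Function.update s.state j true := ⟨i, hσ, hx⟩
  have hci : Classical.choose hi = i := by
    obtain ⟨h1, h2⟩ := Classical.choose_spec hi
    by_contra hne
    have h3 := congrFun (h2.symm.trans hx) (Classical.choose hi)
    rw [Function.update_self, Function.update_of_ne hne, h1] at h3
    exact Bool.noConfusion h3
  unfold incidence
  rw [dif_pos hi]
  simp only [hci]
  unfold kindAt
  by_cases hm : G.IsMergeAt s.state i
  · rw [if_pos hm, if_pos hm, KhFace.edgeVal_merge, KhFace.mergeInc]
    by_cases hc : ∀ c, G.circleOf x.state c ≠ G.circleOf x.state (G.arcIn (G.overPos i)) →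
        x.label c = s.label c
    · rw [if_pos hc, if_pos hc]
    · rw [if_neg hc, if_neg hc, mul_zero]
  · have hsp := hms.resolve_left hm
    rw [if_neg hm, if_pos hsp, if_neg hm, KhFace.edgeVal_split, KhFace.splitInc]
    by_cases hc : ∀ c, G.circleOf s.state c ≠ G.circleOf s.state (G.arcIn (G.overPos i)) →
        x.label c = s.label c
    · rw [if_pos hc, if_pos hc]
    · rw [if_neg hc, if_neg hc, mul_zero]

end Ring

/-! ## Koszul signs anticommute around a face -/

/-- Flipping the `0`-smoothing at `i` adds `i` to the `1`-smoothings below `j` exactly when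
`i < j`. Khovanov (2000), §3.3. [folklore] -/
theorem card_filter_lt_update {σ : G.State} {i : Fin G.n} (hi : σ i = false) (j : Fin G.n) :
    (Finset.univ.filter fun k ↦ k < j ∧ Function.update σ i true k = true).card =
      (Finset.univ.filter fun k ↦ k < j ∧ σ k = true).card + if i < j then 1 else 0 := by
  by_cases hij : i < j
  · rw [if_pos hij]
    have hset : (Finset.univ.filter fun k ↦ k < j ∧ Function.update σ i true k = true) =
        insert i (Finset.univ.filter fun k ↦ k < j ∧ σ k = true) := by
      ext k
      simp only [Finset.mem_filter, Finset.mem_univ, true_and, Finset.mem_insert]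
      by_cases hk : k = i
      · subst hk
        simp [hij]
      · rw [Function.update_of_ne hk]
        simp [hk]
    rw [hset, Finset.card_insert_of_notMem (by simp [hi])]
  · rw [if_neg hij, add_zero]
    congr 1
    ext k
    simp only [Finset.mem_filter, Finset.mem_univ, true_and]
    by_cases hk : k = i
    · subst hk
      simp [hij]
    · rw [Function.update_of_ne hk]

/-- **Koszul signs anticommute.** For two `0`-smoothed chords `i ≠ j` of a state `σ`, the
products of edge signs along the two paths `σ → σ[i↦1] → σ[i↦1][j↦1]` and
`σ → σ[j↦1] → σ[j↦1][i↦1]` are opposite. Khovanov (2000), §3.3 (the skew cube `E_I`);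
Bar-Natan (2002), §3.2. [cite: Khovanov2000, §3.3] -/
theorem edgeSign_mul_edgeSign_update {σ : G.State} {i j : Fin G.n} (hij : i ≠ j)
    (hi : σ i = false) (hj : σ j = false) :
    edgeSign σ i * edgeSign (Function.update σ i true) j =
      -(edgeSign σ j * edgeSign (Function.update σ j true) i) := by
  unfold edgeSign
  rw [card_filter_lt_update hi j, card_filter_lt_update hj i]
  rcases lt_or_gt_of_ne hij with hlt | hlt
  · rw [if_pos hlt, if_neg (not_lt_of_gt hlt)]
    ring
  · rw [if_neg (not_lt_of_gt hlt), if_pos hlt]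
    ring

/-! ## Enhanced states with a fixed state are labellings of its circles -/

/-- The enhanced state with underlying state `τ` and a labelling of the circles of `τ`
(constant on circles, hence on adjacent arcs). [folklore] -/
abbrev ofLab (τ : G.State) (mu : KhFace.Lab (G.circleOf τ)) : G.EnhancedState :=
  ⟨τ, mu.1, fun a b hab ↦ mu.2 a b (circleOf_eq_iff.mpr hab.reachable)⟩

/-- Enhanced states with underlying state `τ` correspond to labellings of the circles of `τ`.
Viro (2004), §5.1. [cite: Viro2004, §5.1] -/
def stateEquivLab (τ : G.State) :
    {x : G.EnhancedState // x.state = τ} ≃ KhFace.Lab (G.circleOf τ) where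
  toFun x := ⟨x.1.label, fun a b hab ↦ x.1.label_eq_of_circleOf_eq (by rw [x.2]; exact hab)⟩
  invFun mu := ⟨G.ofLab τ mu, rfl⟩
  left_inv x := by
    obtain ⟨⟨st, lbl, hl⟩, hx⟩ := x
    simp only at hx
    subst hx
    rfl
  right_inv _ := rfl

/-- **Summing over the enhanced states with a fixed state** is summing over the labellings of
its circles. [folklore] -/
theorem sum_ite_state_eq {R : Type} [CommRing R] (τ : G.State) (Φ : G.EnhancedState → R) :
    ∑ x : G.EnhancedState, (if x.state = τ then Φ x else 0) =
      ∑ mu : KhFace.Lab (G.circleOf τ), Φ (G.ofLab τ mu) := by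
  classical
  rw [← Finset.sum_filter]
  have key : ∑ x ∈ Finset.univ.filter (fun x : G.EnhancedState ↦ x.state = τ), Φ x =
      ∑ x : {x : G.EnhancedState // x.state = τ}, Φ x.1 :=
    Finset.sum_subtype _ (by simp) Φ
  rw [key]
  refine Fintype.sum_equiv (G.stateEquivLab τ) _ _ fun x ↦ ?_
  obtain ⟨⟨st, lbl, hl⟩, hx⟩ := x
  simp only at hx
  subst hx
  rfl

/-! ## Entries of `d²` vanish -/

section Ring

variable {R : Type} [CommRing R]

/-- **A face of the cube anticommutes.** If `s'.state` is `s.state` with the two `0`-smoothings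
`i ≠ j` flipped, and every edge of the cube is a merge or a split, then
`∑ₓ ⟨d s, x⟩ ⟨d x, s'⟩ = 0`: the two paths of the face contribute the same unsigned sum
(`KhFace.face_comm`) with opposite Koszul signs (`edgeSign_mul_edgeSign_update`).
Khovanov (2000), Prop. 8 and §3.3; Bar-Natan (2002), §3.2. [cite: Khovanov2000, Prop. 8] -/
theorem sum_incidence_mul_incidence_face
    (hms : ∀ (σ : G.State) (k : Fin G.n), σ k = false → G.IsMergeAt σ k ∨ G.IsSplitAt σ k)
    (h t : R) {σ : G.State} {la : G.Arc → Bool}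
    {hla : ∀ a b, (G.stateGraph σ).Adj a b → la a = la b} {nu : G.Arc → Bool} {i j : Fin G.n}
    (hij : i ≠ j) (hi : σ i = false) (hj : σ j = false)
    {hnu : ∀ a b, (G.stateGraph (Function.update (Function.update σ i true) j true)).Adj a b →
      nu a = nu b} :
    ∑ x : G.EnhancedState, G.incidence R h t ⟨σ, la, hla⟩ x *
      G.incidence R h t x ⟨Function.update (Function.update σ i true) j true, nu, hnu⟩ = 0 := by
  classical
  have hσij : Function.update σ i true j = false := by
    rw [Function.update_of_ne (Ne.symm hij), hj]
  have hσji : Function.update σ j true i = false := by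
    rw [Function.update_of_ne hij, hi]
  have hcomm : Function.update (Function.update σ i true) j true =
      Function.update (Function.update σ j true) i true :=
    Function.update_comm hij true true σ
  have hne : Function.update σ i true ≠ Function.update σ j true := fun h' ↦ by
    have := congrFun h' i
    rw [Function.update_self, hσji] at this
    exact Bool.noConfusion this
  -- Step A: only the two intermediate states of the face contribute
  have hsplit : ∀ x : G.EnhancedState, G.incidence R h t ⟨σ, la, hla⟩ x *
      G.incidence R h t x ⟨Function.update (Function.update σ i true) j true, nu, hnu⟩ =
      (if x.state = Function.update σ i true then G.incidence R h t ⟨σ, la, hla⟩ x *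
        G.incidence R h t x ⟨Function.update (Function.update σ i true) j true, nu, hnu⟩
        else 0) +
      (if x.state = Function.update σ j true then G.incidence R h t ⟨σ, la, hla⟩ x *
        G.incidence R h t x ⟨Function.update (Function.update σ i true) j true, nu, hnu⟩
        else 0) := by
    intro x
    by_cases hxi : x.state = Function.update σ i true
    · rw [if_pos hxi, if_neg (fun hxj ↦ hne (hxi.symm.trans hxj)), add_zero]
    by_cases hxj : x.state = Function.update σ j true
    · rw [if_neg hxi, if_pos hxj, zero_add]
    rw [if_neg hxi, if_neg hxj, add_zero]
    by_cases h1 : G.incidence R h t ⟨σ, la, hla⟩ x = 0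
    · rw [h1, zero_mul]
    by_cases h2 : G.incidence R h t x
        ⟨Function.update (Function.update σ i true) j true, nu, hnu⟩ = 0
    · rw [h2, mul_zero]
    exfalso
    obtain ⟨k, hk, hxk⟩ := exists_of_incidence_ne_zero h1
    obtain ⟨l, -, hs'l⟩ := exists_of_incidence_ne_zero h2
    simp only at hk hxk hs'l
    -- `k` is a `0`-smoothing of `σ` flipped in `s'`: `k = i` or `k = j`
    have h3 : Function.update (Function.update σ i true) j true k = true := by
      rw [hs'l, hxk]
      by_cases hkl : k = l
      · subst hkl
        rw [Function.update_self]
      · rw [Function.update_of_ne hkl, Function.update_self]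
    by_cases hkj : k = j
    · exact hxj (by rw [hxk, hkj])
    · rw [Function.update_of_ne hkj] at h3
      by_cases hki : k = i
      · exact hxi (by rw [hxk, hki])
      · rw [Function.update_of_ne hki, hk] at h3
        exact Bool.noConfusion h3
  -- Step B: each path is (sign) · (sign) · (abstract face sum)
  have hpath₁ : ∑ x : G.EnhancedState,
      (if x.state = Function.update σ i true then G.incidence R h t ⟨σ, la, hla⟩ x *
        G.incidence R h t x ⟨Function.update (Function.update σ i true) j true, nu, hnu⟩
        else 0) =
      ((edgeSign σ i * edgeSign (Function.update σ i true) j : ℤ) : R) *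
        ∑ mu : KhFace.Lab (G.circleOf (Function.update σ i true)),
          KhFace.edgeVal R h t (G.kindAt σ i) (G.circleOf σ)
              (G.circleOf (Function.update σ i true)) la mu.1
              (G.arcIn (G.overPos i)) (G.arcOut (G.overPos i)) *
            KhFace.edgeVal R h t (G.kindAt (Function.update σ i true) j)
              (G.circleOf (Function.update σ i true))
              (G.circleOf (Function.update (Function.update σ i true) j true)) mu.1 nu
              (G.arcIn (G.overPos j)) (G.arcOut (G.overPos j)) := by
    rw [sum_ite_state_eq, Finset.mul_sum]
    refine Finset.sum_congr rfl fun mu _ ↦ ?_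
    rw [incidence_eq_edgeVal h t (s := ⟨σ, la, hla⟩) (x := G.ofLab _ mu) (i := i) (hms σ i hi)
        hi rfl,
      incidence_eq_edgeVal h t (s := G.ofLab _ mu)
        (x := ⟨Function.update (Function.update σ i true) j true, nu, hnu⟩) (i := j)
        (hms _ j hσij) hσij rfl]
    dsimp only [ofLab]
    push_cast
    ring
  have hpath₂ : ∑ x : G.EnhancedState,
      (if x.state = Function.update σ j true then G.incidence R h t ⟨σ, la, hla⟩ x *
        G.incidence R h t x ⟨Function.update (Function.update σ i true) j true, nu, hnu⟩
        else 0) =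
      ((edgeSign σ j * edgeSign (Function.update σ j true) i : ℤ) : R) *
        ∑ mu : KhFace.Lab (G.circleOf (Function.update σ j true)),
          KhFace.edgeVal R h t (G.kindAt σ j) (G.circleOf σ)
              (G.circleOf (Function.update σ j true)) la mu.1
              (G.arcIn (G.overPos j)) (G.arcOut (G.overPos j)) *
            KhFace.edgeVal R h t (G.kindAt (Function.update σ j true) i)
              (G.circleOf (Function.update σ j true))
              (G.circleOf (Function.update (Function.update σ i true) j true)) mu.1 nu
              (G.arcIn (G.overPos i)) (G.arcOut (G.overPos i)) := by
    rw [sum_ite_state_eq, Finset.mul_sum]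
    refine Finset.sum_congr rfl fun mu _ ↦ ?_
    rw [incidence_eq_edgeVal h t (s := ⟨σ, la, hla⟩) (x := G.ofLab _ mu) (i := j) (hms σ j hj)
        hj rfl,
      incidence_eq_edgeVal h t (s := G.ofLab _ mu)
        (x := ⟨Function.update (Function.update σ i true) j true, nu, hnu⟩) (i := i)
        (hms _ i hσji) hσji hcomm]
    dsimp only [ofLab]
    push_cast
    ring
  -- Step C: the abstract face theorem and the sign rule
  have hface : ∑ mu : KhFace.Lab (G.circleOf (Function.update σ i true)),
      KhFace.edgeVal R h t (G.kindAt σ i) (G.circleOf σ)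
          (G.circleOf (Function.update σ i true)) la mu.1
          (G.arcIn (G.overPos i)) (G.arcOut (G.overPos i)) *
        KhFace.edgeVal R h t (G.kindAt (Function.update σ i true) j)
          (G.circleOf (Function.update σ i true))
          (G.circleOf (Function.update (Function.update σ i true) j true)) mu.1 nu
          (G.arcIn (G.overPos j)) (G.arcOut (G.overPos j)) =
      ∑ mu : KhFace.Lab (G.circleOf (Function.update σ j true)),
        KhFace.edgeVal R h t (G.kindAt σ j) (G.circleOf σ)
            (G.circleOf (Function.update σ j true)) la mu.1
            (G.arcIn (G.overPos j)) (G.arcOut (G.overPos j)) *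
          KhFace.edgeVal R h t (G.kindAt (Function.update σ j true) i)
            (G.circleOf (Function.update σ j true))
            (G.circleOf (Function.update (Function.update σ i true) j true)) mu.1 nu
            (G.arcIn (G.overPos i)) (G.arcOut (G.overPos i)) := by
    -- (`convert`: the `Fintype` instances on labellings found in the abstract and in the
    -- concrete context differ by a `Subsingleton`)
    convert KhFace.face_comm (R := R) (h := h) (t := t) (G.kindAt σ i)
      (G.kindAt (Function.update σ i true) j) (G.kindAt σ j) (G.kindAt (Function.update σ j true) i)
      (edgeOK_kindAt (hms σ i hi) rfl) (edgeOK_kindAt (hms _ j hσij) rfl)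
      (edgeOK_kindAt (hms σ j hj) rfl) (edgeOK_kindAt (hms _ i hσji) hcomm)
      ⟨la, fun a b hab ↦ (⟨σ, la, hla⟩ : G.EnhancedState).label_eq_of_circleOf_eq hab⟩
      ⟨nu, fun a b hab ↦ (⟨Function.update (Function.update σ i true) j true, nu, hnu⟩ :
        G.EnhancedState).label_eq_of_circleOf_eq hab⟩ using 3
  have hsign := congrArg (fun z : ℤ ↦ (z : R)) (edgeSign_mul_edgeSign_update hij hi hj)
  simp only [Int.cast_neg] at hsign
  rw [Finset.sum_congr rfl fun x _ ↦ hsplit x, Finset.sum_add_distrib, hpath₁, hpath₂, hface,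
    hsign]
  ring

/-- **Entries of `d²` vanish.** If every edge of the cube of resolutions of `G` is a merge or a
split, then for all enhanced states `s, s'`, `∑ₓ ⟨d s, x⟩ ⟨d x, s'⟩ = 0` (sum over all enhanced
states `x`). Khovanov (2000), Prop. 8; Bar-Natan (2002), §3.2. [cite: Khovanov2000, Prop. 8] -/
theorem sum_incidence_mul_incidence_eq_zero
    (hms : ∀ (σ : G.State) (k : Fin G.n), σ k = false → G.IsMergeAt σ k ∨ G.IsSplitAt σ k)
    (h t : R) (s s' : G.EnhancedState) :
    ∑ x : G.EnhancedState, G.incidence R h t s x * G.incidence R h t x s' = 0 := by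
  classical
  obtain ⟨σ, la, hla⟩ := s
  obtain ⟨σ', nu, hnu⟩ := s'
  by_cases hij : ∃ i j : Fin G.n, i ≠ j ∧ σ i = false ∧ σ j = false ∧
      σ' = Function.update (Function.update σ i true) j true
  · obtain ⟨i, j, hne, hi, hj, rfl⟩ := hij
    exact sum_incidence_mul_incidence_face hms h t hne hi hj
  · refine Finset.sum_eq_zero fun x _ ↦ ?_
    by_cases h1 : G.incidence R h t ⟨σ, la, hla⟩ x = 0
    · rw [h1, zero_mul]
    by_cases h2 : G.incidence R h t x ⟨σ', nu, hnu⟩ = 0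
    · rw [h2, mul_zero]
    exfalso
    obtain ⟨i, hi, hx⟩ := exists_of_incidence_ne_zero h1
    obtain ⟨j, hj, hs'⟩ := exists_of_incidence_ne_zero h2
    simp only at hi hx hj hs'
    have hne : i ≠ j := by
      rintro rfl
      rw [hx, Function.update_self] at hj
      exact Bool.noConfusion hj
    refine hij ⟨i, j, hne, hi, ?_, ?_⟩
    · rwa [hx, Function.update_of_ne (Ne.symm hne)] at hj
    · rw [hs', hx]

/-- **`d² = 0` from merge-or-split.** If at every `0`-smoothed chord of every state of the
Gauss diagram `G` the flip `0 → 1` is a merge or a split (no one-to-one bifurcation; automatic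
for diagrams of knots, `isMergeAt_or_isSplitAt_of_hasGaussDiagram`), the Khovanov differential
over `A = R[X]/(X² - hX - t)` squares to zero. This is the planarity-free content of
Khovanov (2000), Prop. 8 (commutativity of the cube `V_D`) together with §3.3–3.4 (the skew cube
makes `C(D)` a complex); Bar-Natan (2002), §3.2; Viro (2004), §5.2. [cite: Khovanov2000, Prop. 8] -/
theorem khovanovD_comp_khovanovD_of_isMergeAt_or_isSplitAt (G : GaussDiagram) (R : Type)
    [CommRing R]
    (hms : ∀ (σ : G.State) (k : Fin G.n), σ k = false → G.IsMergeAt σ k ∨ G.IsSplitAt σ k)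
    (h t : R) (i : ℤ) :
    G.khovanovD R h t (i + 1) (i + 1 + 1) ∘ₗ G.khovanovD R h t i (i + 1) = 0 := by
  classical
  rw [khovanovD, khovanovD, ← Matrix.toLin'_mul]
  have hM : ((Matrix.of fun (s' : G.degStates (i + 1 + 1)) (s : G.degStates (i + 1)) ↦
      G.incidence R h t s.1 s'.1) * Matrix.of fun (s' : G.degStates (i + 1))
        (s : G.degStates i) ↦ G.incidence R h t s.1 s'.1) = 0 := by
    ext s' s
    simp only [Matrix.mul_apply, Matrix.of_apply, Matrix.zero_apply]
    have key : ∑ x ∈ Finset.univ.filter (fun x : G.EnhancedState ↦ homDegree x = i + 1),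
        G.incidence R h t s.1 x * G.incidence R h t x s'.1 =
        ∑ s'' : G.degStates (i + 1), G.incidence R h t s.1 s''.1 * G.incidence R h t s''.1 s'.1 :=
      Finset.sum_subtype _ (by simp) fun x ↦ G.incidence R h t s.1 x * G.incidence R h t x s'.1
    calc ∑ s'' : G.degStates (i + 1), G.incidence R h t s''.1 s'.1 * G.incidence R h t s.1 s''.1
        = ∑ s'' : G.degStates (i + 1),
            G.incidence R h t s.1 s''.1 * G.incidence R h t s''.1 s'.1 :=
          Finset.sum_congr rfl fun _ _ ↦ mul_comm _ _
      _ = ∑ x : G.EnhancedState, G.incidence R h t s.1 x * G.incidence R h t x s'.1 := by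
          rw [← key, Finset.sum_filter]
          refine Finset.sum_congr rfl fun x _ ↦ ?_
          by_cases hx : homDegree x = i + 1
          · rw [if_pos hx]
          · rw [if_neg hx]
            by_cases h0 : G.incidence R h t s.1 x = 0
            · rw [h0, zero_mul]
            · exact absurd ((homDegree_eq_of_incidence_ne_zero h0).trans (by rw [s.2])) hx
      _ = 0 := sum_incidence_mul_incidence_eq_zero hms h t s.1 s'.1
  rw [hM, map_zero]

/-- **`d² = 0` for diagrams of knots, from the merge-or-split dichotomy.** The named fact
`khovanovD_comp_khovanovD` of `KhComplex` (Khovanov (2000), Prop. 8) follows from the named fact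
`isMergeAt_or_isSplitAt_of_hasGaussDiagram` of `KhResolutions` (every edge of the cube of a
realisable Gauss diagram is a merge or a split — the planarity input, Jordan curve theorem):
all the remaining combinatorics and algebra are proved above. [cite: Khovanov2000, Prop. 8] -/
theorem khovanovD_comp_khovanovD_of_dichotomy (G : GaussDiagram) (R : Type) [CommRing R]
    (hms : isMergeAt_or_isSplitAt_of_hasGaussDiagram (G := G)) :
    G.khovanovD_comp_khovanovD R :=
  fun h t hG i ↦ khovanovD_comp_khovanovD_of_isMergeAt_or_isSplitAt G R
    (fun _ _ hk ↦ hms hG hk) h t i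

end Ring

end GaussDiagram

end Literature.Topology.FourManifolds
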